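import Mathlib
import HarnessLib
import Literature.Probability.LatticeModels.TorusFourierWeightedConvolution

/-!
# Route `KLProgramme` — crux K3 ENGINE (stmt-HubbardSuperconductivity-20437), stub (e) «(e)-D-ROWS», keying (A′): THE SPACE-TIME CHARACTER SUM OF A SYMBOL TIMES A PURELY
# SPATIAL MULTIPLIER is at most `L⁻²·(spatial ℓ¹ of the multiplier's character sum) × (space-time ℓ¹ of the symbol's character sum)`
# (cell gate-hubbard-kl, seat hubbard-kl-k3c4-p1 g26, VL lane; the first brick of file (1c): the named data `Rδ, Cδ` of `…TwoVolumeDualRowsLastScaleConversion` (p733418) are rows of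
# the overlap kernel of `m − 1 = −κ_D·Ψ_{K₁}` (✓ `…TwoVolumeFrameDressingLastScale`), `κ_D` a function of the SPATIAL momentum only; `TwoLegFourier.rowSum_overlapKernel_eq` turns
# those rows into space-time character sums of the product symbol — this file splits the product)

* **`sum_norm_charSum_spatialMul_le`** — for `D : TorusSite 2 L → ℂ` and `Ψ : TorusSite 1 P × TorusSite 2 L → ℂ`:
  `Σ_{(t,x)} ‖Σ_{(ω,k)} χ_ω(t)χ_k(x)·(D(k)·Ψ(ω,k))‖ ≤ L⁻² · (Σ_x ‖Σ_k D(k)χ_k(x)‖) · (Σ_{(t,x)} ‖Σ_{(ω,k)} χ_ω(t)χ_k(x)·Ψ(ω,k)‖)` —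
  at each time `t` the spatial character sum of `k ↦ D(k)·(Σ_ω χ_ω(t)Ψ(ω,k))` is `L²·` the inverse transform of a pointwise product, i.e. a spatial CONVOLUTION
  (`TorusFourierWeightedConvolution.sum_mul_norm_torusFourierInv_mul_le`, weight `1`).
So the `ℓ¹` datum of the dressing weight factorises into the `ℓ¹` COEFFICIENT norm of the mismatch polynomial `D` (NOT its sup) and the `ℓ¹` of the frame-`K₁` UV symbol's
character sum (the covariance's position rows).  Pure finite Fourier bookkeeping; nothing about the model is asserted.
References: BGM 2006 §3 (3.3) [cite: BenfattoGiulianiMastropietro2006]; Friedli–Velenik 2017 §10.4.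
-/

noncomputable section

namespace Summit.HubbardSuperconductivity.HubbardSuperconductivity.Theorems.TwoVolumeDefect

set_option linter.dupNamespace false -- summit = problem name (single-conjunct summit), D-0017

open Finset Complex Literature.Probability.LatticeModels

variable {P L : ℕ} [NeZero P] [NeZero L]

/-- A spatial character sum is `L²` times the inverse torus transform. [folklore] -/
theorem sum_mul_torusChar_eq_mul_torusFourierInv (g : TorusSite 2 L → ℂ) (x : TorusSite 2 L) :
    ∑ k : TorusSite 2 L, g k * torusChar k x = ((L : ℂ) ^ 2) * torusFourierInv g x := by
  have hL : ((L : ℂ) ^ 2) ≠ 0 := pow_ne_zero _ (Nat.cast_ne_zero.2 (NeZero.ne L))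
  rw [torusFourierInv_eq_sum_torusChar, ← mul_assoc, mul_inv_cancel₀ hL, one_mul]

/-- At a fixed time `t`, the space-time character sum of `(ω,k) ↦ D(k)·Ψ(ω,k)` is the spatial character sum of the pointwise product `k ↦ D(k)·(Σ_ω χ_ω(t)Ψ(ω,k))`. -/
theorem charSum_spatialMul_eq (D : TorusSite 2 L → ℂ) (Ψ : TorusSite 1 P × TorusSite 2 L → ℂ) (t : TorusSite 1 P) (x : TorusSite 2 L) :
    ∑ q : TorusSite 1 P × TorusSite 2 L, (torusChar q.1 t * torusChar q.2 x) • (D q.2 * Ψ q) =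
      ∑ k : TorusSite 2 L, (D k * ∑ ω : TorusSite 1 P, torusChar ω t * Ψ (ω, k)) * torusChar k x := by
  rw [Fintype.sum_prod_type, sum_comm]
  refine sum_congr rfl fun k _ => ?_
  rw [mul_sum, sum_mul]
  refine sum_congr rfl fun ω _ => ?_
  simp only [smul_eq_mul]
  ring

/-- The same for the symbol alone (`D = 1`). -/
theorem charSum_eq_spatial (Ψ : TorusSite 1 P × TorusSite 2 L → ℂ) (t : TorusSite 1 P) (x : TorusSite 2 L) :
    ∑ q : TorusSite 1 P × TorusSite 2 L, (torusChar q.1 t * torusChar q.2 x) • Ψ q =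
      ∑ k : TorusSite 2 L, (∑ ω : TorusSite 1 P, torusChar ω t * Ψ (ω, k)) * torusChar k x := by
  have h := charSum_spatialMul_eq (fun _ => (1 : ℂ)) Ψ t x
  simp only [one_mul] at h
  exact h

/-- **THE SPATIAL-MULTIPLIER SPLIT**: `Σ_{(t,x)} ‖Σ_q χ_q(t,x)·(D(k_q)Ψ(q))‖ ≤ L⁻²·(Σ_x ‖Σ_k D(k)χ_k(x)‖)·(Σ_{(t,x)} ‖Σ_q χ_q(t,x)·Ψ(q)‖)`.
[cite: BenfattoGiulianiMastropietro2006, §3 (3.3)] -/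
theorem sum_norm_charSum_spatialMul_le (D : TorusSite 2 L → ℂ) (Ψ : TorusSite 1 P × TorusSite 2 L → ℂ) :
    ∑ z : TorusSite 1 P × TorusSite 2 L, ‖∑ q : TorusSite 1 P × TorusSite 2 L, (torusChar q.1 z.1 * torusChar q.2 z.2) • (D q.2 * Ψ q)‖ ≤
      ((L : ℝ) ^ 2)⁻¹ * (∑ x : TorusSite 2 L, ‖∑ k : TorusSite 2 L, D k * torusChar k x‖) *
        ∑ z : TorusSite 1 P × TorusSite 2 L, ‖∑ q : TorusSite 1 P × TorusSite 2 L, (torusChar q.1 z.1 * torusChar q.2 z.2) • Ψ q‖ := by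
  have hL0 : (0 : ℝ) < (L : ℝ) ^ 2 := by have := NeZero.pos L; positivity
  have hLc : ‖((L : ℂ) ^ 2)‖ = (L : ℝ) ^ 2 := by rw [norm_pow, Complex.norm_natCast]
  -- per time slice: the Literature convolution bound with weight `1`
  have hslice : ∀ t : TorusSite 1 P,
      ∑ x : TorusSite 2 L, ‖∑ q : TorusSite 1 P × TorusSite 2 L, (torusChar q.1 t * torusChar q.2 x) • (D q.2 * Ψ q)‖ ≤
        ((L : ℝ) ^ 2)⁻¹ * (∑ x : TorusSite 2 L, ‖∑ k : TorusSite 2 L, D k * torusChar k x‖) *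
          ∑ x : TorusSite 2 L, ‖∑ q : TorusSite 1 P × TorusSite 2 L, (torusChar q.1 t * torusChar q.2 x) • Ψ q‖ := by
    intro t
    set f : TorusSite 2 L → ℂ := fun k => ∑ ω : TorusSite 1 P, torusChar ω t * Ψ (ω, k) with hf
    have h1 : ∀ x, ∑ q : TorusSite 1 P × TorusSite 2 L, (torusChar q.1 t * torusChar q.2 x) • (D q.2 * Ψ q) =
        ((L : ℂ) ^ 2) * torusFourierInv (fun k => D k * f k) x := fun x => by
      rw [charSum_spatialMul_eq, ← sum_mul_torusChar_eq_mul_torusFourierInv]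
    have h2 : ∀ x, ∑ q : TorusSite 1 P × TorusSite 2 L, (torusChar q.1 t * torusChar q.2 x) • Ψ q = ((L : ℂ) ^ 2) * torusFourierInv f x :=
      fun x => by rw [charSum_eq_spatial, ← sum_mul_torusChar_eq_mul_torusFourierInv]
    have h3 : ∀ x, ∑ k : TorusSite 2 L, D k * torusChar k x = ((L : ℂ) ^ 2) * torusFourierInv D x :=
      fun x => sum_mul_torusChar_eq_mul_torusFourierInv D x
    simp_rw [h1, h2, h3, norm_mul, hLc, ← mul_sum]
    have hconv := sum_mul_norm_torusFourierInv_mul_le (w := fun _ : TorusSite 2 L => (1 : ℝ)) (fun _ => zero_le_one)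
      (fun _ _ => by rw [one_mul]) D f
    simp only [one_mul] at hconv
    have hA0 : 0 ≤ ∑ x : TorusSite 2 L, ‖torusFourierInv D x‖ := sum_nonneg fun _ _ => norm_nonneg _
    calc (L : ℝ) ^ 2 * ∑ x : TorusSite 2 L, ‖torusFourierInv (fun k => D k * f k) x‖
        ≤ (L : ℝ) ^ 2 * ((∑ x : TorusSite 2 L, ‖torusFourierInv D x‖) * ∑ x : TorusSite 2 L, ‖torusFourierInv f x‖) :=
          mul_le_mul_of_nonneg_left hconv hL0.le
      _ = ((L : ℝ) ^ 2)⁻¹ * ((L : ℝ) ^ 2 * ∑ x : TorusSite 2 L, ‖torusFourierInv D x‖) *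
            ((L : ℝ) ^ 2 * ∑ x : TorusSite 2 L, ‖torusFourierInv f x‖) := by
          field_simp
  -- sum the slices over `t`
  rw [Fintype.sum_prod_type, Fintype.sum_prod_type, mul_sum]
  exact sum_le_sum fun t _ => hslice t

end Summit.HubbardSuperconductivity.HubbardSuperconductivity.Theorems.TwoVolumeDefect

end
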